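import Mathlib
import Literature.AlgebraicGeometry.Resolution.CobordantGame
import Literature.AlgebraicGeometry.Resolution.CobordantChartCoefficients
import Literature.AlgebraicGeometry.Resolution.CobordantChartPlaneSlice
import Literature.AlgebraicGeometry.Resolution.CobordantTupleGame
import Literature.AlgebraicGeometry.Resolution.FormalCoordinateChange
import Summits.ResolutionOfSingularities.ResolutionOfSingularities.Theorems.WeightedInvariantLocalWeightedDropMonicDoublePointLift
import Summits.ResolutionOfSingularities.ResolutionOfSingularities.Theorems.WeightedInvariantLocalWeightedDropTerminalDoublePointsDimSteps

/-!
# `WeightedInvariant.LocalWeightedDrop`: toolkit for the SEPARABLE terminal double points `y² + A₁ y + A₀` in EVERY dimension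

Crux item stmt-ResolutionOfSingularities-8899 `LocalWeightedDrop` (route `ResolutionOfSingularities/WeightedInvariant`), skeleton v30,
residual stubs W4|₄ `stub_wildWideApexFourStartsWon` / W4|₅₊ `stub_wildWideApexFiveUpStartsWon` (their `d = 2` slice is the game on char-2
monic double points `y² + A₁ y + A₀` in `≥ 3` old variables, `wildWideApexHigherStartsWon_two_of_monicForms`).  [OURS · L1 W4.3, chain w43, stub
worker 4 (gen 4): dimension-generic twin of stub worker 2's `SepTerminalDoublePoint` toolkit (S2sT, `m = 1`); NOT a statement of any manuscript.]

Contents (old variables `x₀, …, x_m`, `y = X (Fin.last (m+1))`; every field unless said otherwise):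
* coefficients of `y² + A₁ y + A₀` in the old variables (`coeff_embDomain_dp1`), the `y`-linear coefficient (`coeff_single_last_dp1`);
  `y² + A₁ y + A₀` is not singular when `A₀` has a linear term or `A₁(0) ≠ 0`;
* THE CURVE STEP `won_dp1_of_curveStep` (every characteristic): `A₀ = x_i² A₀'`, `A₁ = x_i A₁'` with `A₀'(0) = A₁'(0) = 0` ⇒ `y² + A₁ y + A₀`
  is won as soon as every SINGULAR slice `y² + c A₁'(ρ_i(c)) y + c² A₀'(ρ_i(c))` (`c ≠ 0`) is won (`won_monic_of_curveBlowup`);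
* THE HYPERBOLIC BOTTOM WITH A `y`-TERM `won_dp1_X_mul_X_mul` (every characteristic): `y² + x_a x_b B y + x_a x_b U`, `U(0) ≠ 0`, is won in ONE
  move `V(x_a, x_b, y)` with no singular successor;
* THE TWO-SHEETS BOTTOM `won_dp1_X_sq_mul` (characteristic `2`): `y² + x_a V y + x_a² W`, `V(0) ≠ 0`, is won in ONE move `V(x_a, y)` with no
  singular successor (at `c_a ≠ 0` the `y`-linear term `c_a V(0)` survives because `2γ = 0`).
-/

set_option linter.dupNamespace false -- mandated namespace of this single-conjunct summit

namespace Summit.ResolutionOfSingularities.ResolutionOfSingularities.Theorems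

open Literature.AlgebraicGeometry.Resolution
open Literature.AlgebraicGeometry.Resolution.CobordantGame

namespace SepTerminalDoublePointDim

open MvPowerSeries TerminalDoublePointDim

variable {k : Type} [Field k] {m : ℕ}

/-! ### Coefficients of `y² + A₁ y + A₀` -/

/-- The coefficient of `y² + A₁ y + A₀` at a `y`-free exponent `x^β` is the coefficient of `A₀` at `β`. -/
theorem coeff_embDomain_dp1 (A₀ A₁ : MvPowerSeries (Fin (m + 1)) k) (β : Fin (m + 1) →₀ ℕ) :
    coeff (Finsupp.embDomain (Fin.succAboveEmb (Fin.last (m + 1))) β)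
        (X (Fin.last (m + 1)) ^ 2 + (rename (Fin.succAboveEmb (Fin.last (m + 1))) A₀ +
          rename (Fin.succAboveEmb (Fin.last (m + 1))) A₁ * X (Fin.last (m + 1)))) = coeff β A₀ := by
  classical
  rw [← add_assoc, map_add, coeff_embDomain_dp, mul_comm, X_def, coeff_monomial_mul, if_neg, add_zero]
  rw [Finsupp.single_le_iff, Finsupp.embDomain_notin_range _ _ _ (by simp)]
  exact Nat.not_succ_le_zero 0

/-- `y² + A₁ y + A₀` is NOT singular as soon as `A₀` has a non-zero linear coefficient. -/
theorem not_isSingular_dp1_of_coeff_ne_zero {A₀ A₁ : MvPowerSeries (Fin (m + 1)) k} (l : Fin (m + 1))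
    (h : coeff (Finsupp.single l 1) A₀ ≠ 0) :
    ¬ CobordantGame.IsSingular k (X (Fin.last (m + 1)) ^ 2 + (rename (Fin.succAboveEmb (Fin.last (m + 1))) A₀ +
      rename (Fin.succAboveEmb (Fin.last (m + 1))) A₁ * X (Fin.last (m + 1)))) := by
  intro hS
  apply h
  rw [← coeff_embDomain_dp1 A₀ A₁, embDomain_single]
  exact hS.2.2 _

/-- The `y`-linear coefficient of `y² + A₁ y + A₀` is `A₁(0)`. -/
theorem coeff_single_last_dp1 (A₀ A₁ : MvPowerSeries (Fin (m + 1)) k) :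
    coeff (Finsupp.single (Fin.last (m + 1)) 1)
        (X (Fin.last (m + 1)) ^ 2 + (rename (Fin.succAboveEmb (Fin.last (m + 1))) A₀ +
          rename (Fin.succAboveEmb (Fin.last (m + 1))) A₁ * X (Fin.last (m + 1)))) = constantCoeff A₁ := by
  rw [map_add, map_add, coeff_X_pow, if_neg (fun h => by
      have := congrArg (fun e => e (Fin.last (m + 1))) h
      simp at this), zero_add, MultiplicityLift.coeff_single_rename_eq_zero A₀ one_ne_zero, zero_add, mul_comm,
    coeff_single_X_mul', constantCoeff_rename]

/-- `y² + A₁ y + A₀` is NOT singular when `A₁(0) ≠ 0` (the linear term `A₁(0) · y`). -/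
theorem not_isSingular_dp1_of_constantCoeff_ne_zero {A₀ A₁ : MvPowerSeries (Fin (m + 1)) k} (h : constantCoeff A₁ ≠ 0) :
    ¬ CobordantGame.IsSingular k (X (Fin.last (m + 1)) ^ 2 + (rename (Fin.succAboveEmb (Fin.last (m + 1))) A₀ +
      rename (Fin.succAboveEmb (Fin.last (m + 1))) A₁ * X (Fin.last (m + 1)))) := by
  intro hS
  apply h
  rw [← coeff_single_last_dp1 A₀ A₁]
  exact hS.2.2 _

/-! ### The curve step on `y² + A₁ y + A₀` (every dimension) -/

/-- THE CURVE STEP.  If `A₀ = x_i² · A₀'`, `A₁ = x_i · A₁'` with `A₀'(0) = A₁'(0) = 0`, blowing up `V(x_i, y)` (`won_monic_of_curveBlowup`)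
wins `y² + A₁ y + A₀` as soon as every SINGULAR slice `y² + c · A₁'(ρ_i(c)) · y + c² · A₀'(ρ_i(c))` (`c ≠ 0`) is won. -/
theorem won_dp1_of_curveStep (p : ℕ) (hp : p.Prime) (k : Type) [Field k] [CharP k p] {m : ℕ} (i : Fin (m + 1))
    (A₀ A₀' A₁ A₁' : MvPowerSeries (Fin (m + 1)) k) (hdiv₀ : A₀ = X i ^ 2 * A₀') (hdiv₁ : A₁ = X i * A₁')
    (h0 : constantCoeff A₀' = 0) (h1 : constantCoeff A₁' = 0)
    (hsucc : ∀ c : k, c ≠ 0 →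
      CobordantGame.IsSingular k (X (Fin.last (m + 1)) ^ 2 + (rename (Fin.succAboveEmb (Fin.last (m + 1)))
        (C (c ^ 2) * subst (fun l : Fin (m + 1) => if l = i then C c * X 0
          else (X (Fin.predAbove i l.succ) : MvPowerSeries (Fin (m + 1)) k)) A₀') +
        rename (Fin.succAboveEmb (Fin.last (m + 1)))
        (C c * subst (fun l : Fin (m + 1) => if l = i then C c * X 0
          else (X (Fin.predAbove i l.succ) : MvPowerSeries (Fin (m + 1)) k)) A₁') * X (Fin.last (m + 1)))) →
      CobordantGame.Won k (m + 1 + 1) (X (Fin.last (m + 1)) ^ 2 + (rename (Fin.succAboveEmb (Fin.last (m + 1)))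
        (C (c ^ 2) * subst (fun l : Fin (m + 1) => if l = i then C c * X 0
          else (X (Fin.predAbove i l.succ) : MvPowerSeries (Fin (m + 1)) k)) A₀') +
        rename (Fin.succAboveEmb (Fin.last (m + 1)))
        (C c * subst (fun l : Fin (m + 1) => if l = i then C c * X 0
          else (X (Fin.predAbove i l.succ) : MvPowerSeries (Fin (m + 1)) k)) A₁') * X (Fin.last (m + 1))))) :
    CobordantGame.Won k (m + 1 + 1) (X (Fin.last (m + 1)) ^ 2 + (rename (Fin.succAboveEmb (Fin.last (m + 1))) A₀ +
      rename (Fin.succAboveEmb (Fin.last (m + 1))) A₁ * X (Fin.last (m + 1)))) := by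
  classical
  rw [MonicDoublePointLift.monic_two_eq_sum]
  refine won_monic_of_curveBlowup p hp k (m + 1) 2 two_pos i (![A₀, A₁]) (![A₀', A₁']) ?_ ?_ ?_
  · intro j
    fin_cases j
    · simpa using hdiv₀
    · simpa using hdiv₁
  · intro j
    fin_cases j
    · simpa using h0
    · simpa using h1
  · intro c hc hS
    have hSeq : X (Fin.last (m + 1)) ^ 2 + ∑ j : Fin 2, rename (Fin.succAboveEmb (Fin.last (m + 1)))
        (C (c ^ (2 - (j : ℕ))) * TupleGame.slice i (subst (CobordantChart.chart (fun l : Fin (m + 1) => if l = i then 1 else 0)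
          (fun l : Fin (m + 1) => if l = i then c else 0)) ((![A₀', A₁'] : Fin 2 → MvPowerSeries (Fin (m + 1)) k) j))) *
          X (Fin.last (m + 1)) ^ (j : ℕ) =
        X (Fin.last (m + 1)) ^ 2 + (rename (Fin.succAboveEmb (Fin.last (m + 1)))
          (C (c ^ 2) * subst (fun l : Fin (m + 1) => if l = i then C c * X 0
            else (X (Fin.predAbove i l.succ) : MvPowerSeries (Fin (m + 1)) k)) A₀') +
          rename (Fin.succAboveEmb (Fin.last (m + 1)))
          (C c * subst (fun l : Fin (m + 1) => if l = i then C c * X 0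
            else (X (Fin.predAbove i l.succ) : MvPowerSeries (Fin (m + 1)) k)) A₁') * X (Fin.last (m + 1))) := by
      rw [Fin.sum_univ_two]
      simp only [Matrix.cons_val_zero, Matrix.cons_val_one, Fin.val_zero, Fin.val_one,
        Nat.sub_zero, Nat.reduceSub, pow_zero, mul_one, pow_one, slice_subst_chart]
    rw [hSeq] at hS ⊢
    exact hsucc c hc hS

/-! ### One-move bottoms -/

/-- No `x_v`-linear term in `s · R` for `v ≠ s`. -/
theorem coeff_single_X_zero_mul_of_ne {N : ℕ} (v : Fin (N + 1)) (hv : v ≠ 0) (R : MvPowerSeries (Fin (N + 1)) k) :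
    coeff (Finsupp.single v 1) (X 0 * R) = 0 :=
  coeff_single_X_mul_of_ne (fun h => hv h.symm) R

/-- THE HYPERBOLIC BOTTOM WITH A `y`-TERM `y² + x_a x_b B · y + x_a x_b U` (`a ≠ b`, `U(0) ≠ 0`; every characteristic, every field,
every dimension, NO hypothesis on other germs): won in ONE move, the blow-up of the line `V(x_a, x_b, y)` — no singular exceptional point
(`c_a ≠ 0` leaves `c_a U(0) · x_b'`, `c_b ≠ 0` leaves `c_b U(0) · x_a'`, `c_a = c_b = 0` forces `γ ≠ 0` and the constant `γ²`; the
`y`-coefficient only contributes multiples of `s`). -/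
theorem won_dp1_X_mul_X_mul (k : Type) [Field k] {m : ℕ} (a b : Fin (m + 1)) (hab : a ≠ b)
    {U : MvPowerSeries (Fin (m + 1)) k} (hU : constantCoeff U ≠ 0) (Bc : MvPowerSeries (Fin (m + 1)) k) :
    CobordantGame.Won k (m + 1 + 1) (X (Fin.last (m + 1)) ^ 2 + (rename (Fin.succAboveEmb (Fin.last (m + 1))) (X a * X b * U) +
      rename (Fin.succAboveEmb (Fin.last (m + 1))) (X a * X b * Bc) * X (Fin.last (m + 1)))) := by
  classical
  set w : Fin (m + 1) → ℕ := fun l => if l = a ∨ l = b then 1 else 0 with hw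
  set Wt : Fin (m + 1 + 1) → ℕ := Fin.insertNth (α := fun _ => ℕ) (Fin.last (m + 1)) 1 w with hWtdef
  set P : MvPowerSeries (Fin (m + 1 + 1)) k := X (Fin.last (m + 1)) ^ 2 +
    (rename (Fin.succAboveEmb (Fin.last (m + 1))) (X a * X b * U) +
      rename (Fin.succAboveEmb (Fin.last (m + 1))) (X a * X b * Bc) * X (Fin.last (m + 1))) with hP
  have hWtlast : Wt (Fin.last (m + 1)) = 1 := by rw [hWtdef, Fin.insertNth_apply_same]
  have hWtcast : ∀ l, Wt (Fin.castSucc l) = w l := fun l => by rw [hWtdef, MonicLinearBlowup.insertNth_castSucc]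
  have hwa : w a = 1 := by rw [hw]; dsimp only; rw [if_pos (Or.inl rfl)]
  have hwb : w b = 1 := by rw [hw]; dsimp only; rw [if_pos (Or.inr rfl)]
  have hmove : IsMove k (X : Fin (m + 1 + 1) → MvPowerSeries (Fin (m + 1 + 1)) k) Wt := by
    refine ⟨fun l => constantCoeff_X l, ?_, ⟨Fin.last (m + 1), by rw [hWtlast]; exact one_pos⟩⟩
    rw [← FormalCoordChange.linSubst_one, ConeDichotomy.linMat_linSubst, Matrix.det_one]
    exact isUnit_one
  refine Won.move X Wt hmove fun g hg => ?_
  obtain ⟨pt, e, ⟨l, hWl, hptl⟩, hfac, hndvd, hsing⟩ := hg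
  exfalso
  have hself : subst (X : Fin (m + 1 + 1) → MvPowerSeries (Fin (m + 1 + 1)) k) P = P := by
    rw [subst_self]; rfl
  rw [hself] at hfac
  set c : Fin (m + 1) → k := fun l => if 0 < w l then pt (Fin.castSucc l) else 0 with hc
  have hc0 : ∀ l, w l = 0 → c l = 0 := fun l hl => by
    rw [hc]; dsimp only; rw [hl, if_neg (lt_irrefl 0)]
  have hca : c a = pt (Fin.castSucc a) := by rw [hc]; dsimp only; rw [hwa, if_pos one_pos]
  have hcb : c b = pt (Fin.castSucc b) := by rw [hc]; dsimp only; rw [hwb, if_pos one_pos]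
  have hch := CobordantChart.hasSubst_chart w c hc0
  set Uc : MvPowerSeries (Fin (m + 1 + 1)) k := subst (CobordantChart.chart w c) U with hUc
  set Bcc : MvPowerSeries (Fin (m + 1 + 1)) k := subst (CobordantChart.chart w c) Bc with hBcc
  have hUc0 : constantCoeff Uc = constantCoeff U := constantCoeff_subst_chart w c hc0 U
  set F : MvPowerSeries (Fin (m + 1 + 1)) k := (C (c a) + X a.succ) * (C (c b) + X b.succ) * Uc with hF
  set F₁ : MvPowerSeries (Fin (m + 1 + 1)) k := X 0 * ((C (c a) + X a.succ) * (C (c b) + X b.succ) * Bcc) with hF₁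
  set B : Fin 2 → MvPowerSeries (Fin (m + 1 + 1)) k := ![F, F₁] with hB
  have hBfac : ∀ j : Fin 2, subst (CobordantChart.chart w c)
      ((![X a * X b * U, X a * X b * Bc] : Fin 2 → MvPowerSeries (Fin (m + 1)) k) j) = X 0 ^ (2 - (j : ℕ)) * B j := by
    intro j
    fin_cases j
    · simp only [hB, hF, Fin.zero_eta, Matrix.cons_val_zero, Nat.sub_zero]
      rw [subst_mul hch, subst_mul hch, subst_X hch, subst_X hch, CobordantChart.chart_apply, CobordantChart.chart_apply, hwa, hwb]
      ring
    · simp only [hB, hF₁, Fin.mk_one, Matrix.cons_val_one, Matrix.cons_val_zero]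
      rw [subst_mul hch, subst_mul hch, subst_X hch, subst_X hch, CobordantChart.chart_apply, CobordantChart.chart_apply, hwa, hwb]
      ring
  set γ : k := pt (Fin.last (m + 1)) with hγ
  set g₀ : MvPowerSeries (Fin (m + 1 + 1 + 1)) k := (C γ + X (Fin.last (m + 1 + 1))) ^ 2 +
    ∑ j : Fin 2, rename (Fin.succAboveEmb (Fin.last (m + 1 + 1))) (B j) * (C γ + X (Fin.last (m + 1 + 1))) ^ (j : ℕ) with hg₀
  have hT : subst (cruxChart k Wt pt) P = X 0 ^ 2 * g₀ := by
    rw [hP, MonicDoublePointLift.monic_two_eq_sum, hWtdef, MonicLinearBlowup.transform_linear w _ pt B hBfac]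
  have hndvd₀ : ¬ X 0 ∣ g₀ := MonicLinearBlowup.not_X_dvd_g₀ γ B
  rw [hT] at hfac
  obtain ⟨-, hgg⟩ := X_pow_mul_eq_X_pow_mul 0 hfac hndvd₀ hndvd
  subst hgg
  have h0 : (Fin.succAboveEmb (Fin.last (m + 1 + 1))) (0 : Fin (m + 1 + 1)) = 0 := succAboveEmb_succ_zero (Fin.last (m + 1))
  have hg₀' : g₀ = (C γ + X (Fin.last (m + 1 + 1))) ^ 2 + rename (Fin.succAboveEmb (Fin.last (m + 1 + 1))) F +
      X 0 * (rename (Fin.succAboveEmb (Fin.last (m + 1 + 1))) ((C (c a) + X a.succ) * (C (c b) + X b.succ) * Bcc) *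
        (C γ + X (Fin.last (m + 1 + 1)))) := by
    rw [hg₀, Fin.sum_univ_two]
    simp only [hB, hF₁, Matrix.cons_val_zero, Matrix.cons_val_one, Fin.val_zero, Fin.val_one, pow_zero, mul_one,
      pow_one, map_mul, rename_X, h0]
    ring
  by_cases ha : pt (Fin.castSucc a) = 0
  · by_cases hb : pt (Fin.castSucc b) = 0
    · -- `c_a = c_b = 0`: the live slot is `y`, `γ ≠ 0`, and `g₀(0) = γ² ≠ 0`
      have hl : l = Fin.last (m + 1) := by
        rcases Fin.eq_castSucc_or_eq_last l with ⟨i, rfl⟩ | h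
        · exfalso
          have hwi : 0 < w i := by rwa [hWtcast] at hWl
          rw [hw] at hwi
          dsimp only at hwi
          by_cases hi : i = a ∨ i = b
          · rcases hi with rfl | rfl
            · exact hptl ha
            · exact hptl hb
          · rw [if_neg hi] at hwi
            exact lt_irrefl 0 hwi
        · exact h
      have hγ0 : γ ≠ 0 := by rw [hγ, ← hl]; exact hptl
      have h00 := hsing.1
      rw [hg₀', map_add, map_add, constantCoeff_C_add_X_sq, constantCoeff_rename, hF, map_mul, map_mul, map_add, map_add,
        constantCoeff_C, constantCoeff_C, constantCoeff_X, constantCoeff_X, add_zero, add_zero, hca, ha, zero_mul, zero_mul,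
        add_zero, map_mul, map_mul, constantCoeff_X, zero_mul, add_zero] at h00
      exact hγ0 (pow_eq_zero_iff two_ne_zero |>.mp h00)
    · -- `c_b ≠ 0`: the linear term `c_b U(0) · x_a'` survives
      have h1 := hsing.2 (Fin.castSucc a.succ)
      rw [hg₀', map_add, map_add, coeff_single_C_add_X_sq_of_ne γ _ (Fin.castSucc_lt_last _).ne, zero_add,
        coeff_single_X_zero_mul_of_ne _ (Fin.castSucc_ne_zero_iff.mpr (Fin.succ_ne_zero a)), add_zero,
        ← embDomain_single (m := m + 1), coeff_embDomain_rename, hF,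
        mul_comm (C (c a) + X a.succ) (C (c b) + X b.succ),
        coeff_single_linFactors_mul (fun h => hab (Fin.succ_injective _ h).symm) (c b) (c a) Uc
          (coeff_single_succ_subst_chart w c hc0 U a (by rw [hwa]; exact one_ne_zero)), hUc0, hcb] at h1
      exact mul_ne_zero hb hU h1
  · -- `c_a ≠ 0`: the linear term `c_a U(0) · x_b'` survives
    have h1 := hsing.2 (Fin.castSucc b.succ)
    rw [hg₀', map_add, map_add, coeff_single_C_add_X_sq_of_ne γ _ (Fin.castSucc_lt_last _).ne, zero_add,
      coeff_single_X_zero_mul_of_ne _ (Fin.castSucc_ne_zero_iff.mpr (Fin.succ_ne_zero b)), add_zero,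
      ← embDomain_single (m := m + 1), coeff_embDomain_rename, hF,
      coeff_single_linFactors_mul (fun h => hab (Fin.succ_injective _ h)) (c a) (c b) Uc
        (coeff_single_succ_subst_chart w c hc0 U b (by rw [hwb]; exact one_ne_zero)), hUc0, hca] at h1
    exact mul_ne_zero ha hU h1


/-- The `Y`-linear coefficient of `(γ + Y)²` is `2γ`. -/
theorem coeff_single_last_C_add_X_sq {N : ℕ} (γ : k) :
    coeff (Finsupp.single (Fin.last N) 1) ((C γ + X (Fin.last N)) ^ 2 : MvPowerSeries (Fin (N + 1)) k) = 2 * γ := by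
  have h : ((C γ + X (Fin.last N)) ^ 2 : MvPowerSeries (Fin (N + 1)) k) =
      C (γ ^ 2) + C (2 * γ) * X (Fin.last N) + X (Fin.last N) ^ 2 := by
    rw [map_pow, map_mul, map_ofNat]; ring
  rw [h, map_add, map_add, coeff_C, if_neg (Finsupp.single_ne_zero.mpr one_ne_zero), coeff_C_mul, coeff_X, if_pos rfl, mul_one,
    coeff_X_pow, if_neg, zero_add, add_zero]
  rw [Finsupp.single_eq_single_iff]
  rintro (⟨-, h12⟩ | ⟨h10, -⟩)
  · exact absurd h12 (by norm_num)
  · exact absurd h10 one_ne_zero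

/-- The `Y`-linear coefficient of `G♮ · (γ + Y)` is `G(0)` (`G` in the old slots and `s`). -/
theorem coeff_single_last_rename_mul_C_add_X {N : ℕ} (γ : k) (G : MvPowerSeries (Fin (N + 1)) k) :
    coeff (Finsupp.single (Fin.last (N + 1)) 1)
        (rename (Fin.succAboveEmb (Fin.last (N + 1))) G * (C γ + X (Fin.last (N + 1)))) = constantCoeff G := by
  rw [mul_add, map_add, mul_comm _ (C γ), coeff_C_mul, MultiplicityLift.coeff_single_rename_eq_zero G one_ne_zero, mul_zero,
    zero_add, mul_comm, coeff_single_X_mul', constantCoeff_rename]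

/-- THE TWO-SHEETS BOTTOM `y² + x_a V · y + x_a² W` (`V(0) ≠ 0`; CHARACTERISTIC `2`, every field, every dimension, NO hypothesis on
other germs): won in ONE move, the blow-up of `V(x_a, y)` — no singular exceptional point (`c_a = 0` forces `γ ≠ 0` and the constant
`γ²`; at `c_a ≠ 0` the `y`-linear coefficient is `2γ + c_a V(0) = c_a V(0) ≠ 0`). -/
theorem won_dp1_X_sq_mul (k : Type) [Field k] [CharP k 2] {m : ℕ} (a : Fin (m + 1))
    {V : MvPowerSeries (Fin (m + 1)) k} (hV : constantCoeff V ≠ 0) (W : MvPowerSeries (Fin (m + 1)) k) :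
    CobordantGame.Won k (m + 1 + 1) (X (Fin.last (m + 1)) ^ 2 + (rename (Fin.succAboveEmb (Fin.last (m + 1))) (X a ^ 2 * W) +
      rename (Fin.succAboveEmb (Fin.last (m + 1))) (X a * V) * X (Fin.last (m + 1)))) := by
  classical
  set w : Fin (m + 1) → ℕ := fun l => if l = a then 1 else 0 with hw
  set Wt : Fin (m + 1 + 1) → ℕ := Fin.insertNth (α := fun _ => ℕ) (Fin.last (m + 1)) 1 w with hWtdef
  set P : MvPowerSeries (Fin (m + 1 + 1)) k := X (Fin.last (m + 1)) ^ 2 +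
    (rename (Fin.succAboveEmb (Fin.last (m + 1))) (X a ^ 2 * W) +
      rename (Fin.succAboveEmb (Fin.last (m + 1))) (X a * V) * X (Fin.last (m + 1))) with hP
  have hWtlast : Wt (Fin.last (m + 1)) = 1 := by rw [hWtdef, Fin.insertNth_apply_same]
  have hWtcast : ∀ l, Wt (Fin.castSucc l) = w l := fun l => by rw [hWtdef, MonicLinearBlowup.insertNth_castSucc]
  have hwa : w a = 1 := by rw [hw]; dsimp only; rw [if_pos rfl]
  have hmove : IsMove k (X : Fin (m + 1 + 1) → MvPowerSeries (Fin (m + 1 + 1)) k) Wt := by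
    refine ⟨fun l => constantCoeff_X l, ?_, ⟨Fin.last (m + 1), by rw [hWtlast]; exact one_pos⟩⟩
    rw [← FormalCoordChange.linSubst_one, ConeDichotomy.linMat_linSubst, Matrix.det_one]
    exact isUnit_one
  refine Won.move X Wt hmove fun g hg => ?_
  obtain ⟨pt, e, ⟨l, hWl, hptl⟩, hfac, hndvd, hsing⟩ := hg
  exfalso
  have hself : subst (X : Fin (m + 1 + 1) → MvPowerSeries (Fin (m + 1 + 1)) k) P = P := by
    rw [subst_self]; rfl
  rw [hself] at hfac
  set c : Fin (m + 1) → k := fun l => if 0 < w l then pt (Fin.castSucc l) else 0 with hc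
  have hc0 : ∀ l, w l = 0 → c l = 0 := fun l hl => by
    rw [hc]; dsimp only; rw [hl, if_neg (lt_irrefl 0)]
  have hca : c a = pt (Fin.castSucc a) := by rw [hc]; dsimp only; rw [hwa, if_pos one_pos]
  have hch := CobordantChart.hasSubst_chart w c hc0
  set Vc : MvPowerSeries (Fin (m + 1 + 1)) k := subst (CobordantChart.chart w c) V with hVc
  set Wc : MvPowerSeries (Fin (m + 1 + 1)) k := subst (CobordantChart.chart w c) W with hWc
  have hVc0 : constantCoeff Vc = constantCoeff V := constantCoeff_subst_chart w c hc0 V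
  set B : Fin 2 → MvPowerSeries (Fin (m + 1 + 1)) k := ![(C (c a) + X a.succ) ^ 2 * Wc, (C (c a) + X a.succ) * Vc] with hB
  have hBfac : ∀ j : Fin 2, subst (CobordantChart.chart w c)
      ((![X a ^ 2 * W, X a * V] : Fin 2 → MvPowerSeries (Fin (m + 1)) k) j) = X 0 ^ (2 - (j : ℕ)) * B j := by
    intro j
    fin_cases j
    · simp only [hB, Fin.zero_eta, Matrix.cons_val_zero, Nat.sub_zero]
      rw [subst_mul hch, subst_pow hch, subst_X hch, CobordantChart.chart_apply, hwa]
      ring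
    · simp only [hB, Fin.mk_one, Matrix.cons_val_one, Matrix.cons_val_zero]
      rw [subst_mul hch, subst_X hch, CobordantChart.chart_apply, hwa]
      ring
  set γ : k := pt (Fin.last (m + 1)) with hγ
  set g₀ : MvPowerSeries (Fin (m + 1 + 1 + 1)) k := (C γ + X (Fin.last (m + 1 + 1))) ^ 2 +
    ∑ j : Fin 2, rename (Fin.succAboveEmb (Fin.last (m + 1 + 1))) (B j) * (C γ + X (Fin.last (m + 1 + 1))) ^ (j : ℕ) with hg₀
  have hT : subst (cruxChart k Wt pt) P = X 0 ^ 2 * g₀ := by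
    rw [hP, MonicDoublePointLift.monic_two_eq_sum, hWtdef, MonicLinearBlowup.transform_linear w _ pt B hBfac]
  have hndvd₀ : ¬ X 0 ∣ g₀ := MonicLinearBlowup.not_X_dvd_g₀ γ B
  rw [hT] at hfac
  obtain ⟨-, hgg⟩ := X_pow_mul_eq_X_pow_mul 0 hfac hndvd₀ hndvd
  subst hgg
  have hg₀' : g₀ = (C γ + X (Fin.last (m + 1 + 1))) ^ 2 +
      rename (Fin.succAboveEmb (Fin.last (m + 1 + 1))) ((C (c a) + X a.succ) ^ 2 * Wc) +
      rename (Fin.succAboveEmb (Fin.last (m + 1 + 1))) ((C (c a) + X a.succ) * Vc) * (C γ + X (Fin.last (m + 1 + 1))) := by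
    rw [hg₀, Fin.sum_univ_two]
    simp only [hB, Matrix.cons_val_zero, Matrix.cons_val_one, Fin.val_zero, Fin.val_one, pow_zero, mul_one, pow_one]
    ring
  by_cases ha : pt (Fin.castSucc a) = 0
  · -- `c_a = 0`: the live slot is `y`, `γ ≠ 0`, `g₀(0) = γ²`
    have hl : l = Fin.last (m + 1) := by
      rcases Fin.eq_castSucc_or_eq_last l with ⟨i, rfl⟩ | h
      · exfalso
        have hwi : 0 < w i := by rwa [hWtcast] at hWl
        rw [hw] at hwi
        dsimp only at hwi
        by_cases hi : i = a
        · subst hi; exact hptl ha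
        · rw [if_neg hi] at hwi
          exact lt_irrefl 0 hwi
      · exact h
    have hγ0 : γ ≠ 0 := by rw [hγ, ← hl]; exact hptl
    have h00 := hsing.1
    rw [hg₀'] at h00
    simp only [map_add, map_mul, map_pow, constantCoeff_rename, constantCoeff_C, constantCoeff_X, add_zero, hca, ha,
      zero_pow two_ne_zero, zero_mul] at h00
    exact hγ0 (pow_eq_zero_iff two_ne_zero |>.mp h00)
  · -- `c_a ≠ 0`: the `y`-linear coefficient is `2γ + c_a V(0) = c_a V(0)`
    have h1 := hsing.2 (Fin.last (m + 1 + 1))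
    rw [hg₀', map_add, map_add, coeff_single_last_C_add_X_sq, CharTwo.two_eq_zero, zero_mul, zero_add,
      MultiplicityLift.coeff_single_rename_eq_zero _ one_ne_zero, zero_add, coeff_single_last_rename_mul_C_add_X, map_mul,
      map_add, constantCoeff_C, constantCoeff_X, add_zero, hVc0, hca] at h1
    exact mul_ne_zero ha hV h1

end SepTerminalDoublePointDim

end Summit.ResolutionOfSingularities.ResolutionOfSingularities.Theorems
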